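import Mathlib
import Summits.Ventures.CertifiedArithmetic.LowPrec.OptW11Cert

/-!
# Opt / S15(i) — W11 window optimality for `k ≤ 27`: soundness of the cell-certificate checker (part 2 of 4)

HONEST FRAMING (venture CertifiedArithmetic / cell `pub-lowprec`, seat OPT, gen 19): certified error
envelopes and provably optimal rounding/accumulation schemes for low-precision formats under stated
cost models; every table by two implementations; no hardware or vendor claims.

THEOREM (`W11Cert.sound`): if `c.check N = true` then `W11CellWin K c.m (c.m + 16 - c.d) N` — in class `c.m`
(block maximum `a` with `6 X(c.m+15) < a ≤ 6 X(c.m+16)`, scales normalised so that `64 s(r) = w11sY r`), every block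
of at most `N + 1` elements in `[0, a]` is quantised by one of the eleven window codes (relative indices
`c.m + 12, …, c.m + 22`) with block SSE at most that of the competitor of relative index `c.m + 16 - c.d`.
PROOF: on each helper piece the window errors are bounded ABOVE by the distance to the anchored grid point
(`gridDist_le_of_mem`) and the competitor's error BELOW through two adjacent grid points or the top
(`le_err_of_between`, `le_err_of_top`, from `OptW11ViolationBlock`), whence
`4096 Φ(y) = 4096 ∑_w lam_w (err_w(y)² - err_t(y)²) ≤ gK(64 y)`, an AFFINE function of `y` checked `≤ 4096 L` at
both piece ends; likewise `Z ≤ rK(64 a) ≤ -4096 Φ(a)` on the class interval.  Summing over the block,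
`∑_w lam_w (SSE_t - SSE_w) = ∑_i (-Φ(x_i)) ≥ Z/4096 - N L > 0`, so not every window code loses.  The cell
certificates themselves are checked in part 3 (`OptW11CertTableA` … `D`), the assembly over all blocks and all competing
scales of the grid is part 4 (`OptW11Exact`).
-/

namespace Summit.Ventures.CertifiedArithmetic.LowPrec.Opt

section Sound

variable {K : Type*} [Field K] [LinearOrder K] [IsStrictOrderedRing K]

/-- THE CELL STATEMENT `W11CellWin K m rt N`: for every block `x` of `k ≤ N + 1` elements in `[0, x i₀]` whose
maximum `x i₀` lies in class `m` — `12·w11sY(m+15)/64 < x i₀ ≤ 12·w11sY(m+16)/64` — one of the eleven window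
codes (relative indices `m+12, …, m+22`) has block SSE at most that of the code of relative index `rt`.
[definition] -/
def W11CellWin (K : Type*) [Field K] [LinearOrder K] [IsStrictOrderedRing K] (m rt N : ℕ) : Prop :=
  ∀ (k : ℕ) (x : Fin k → K) (i₀ : Fin k), k ≤ N + 1 → (∀ i, 0 ≤ x i ∧ x i ≤ x i₀) →
    ((12 * w11sY (m + 15) : ℕ) : K) / 64 < x i₀ → x i₀ ≤ ((12 * w11sY (m + 16) : ℕ) : K) / 64 →
    ∃ w : Fin 11, blockSSE e2m1Lo_ne (((w11sY (m + w + 12) : ℕ) : K) / 64) x ≤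
      blockSSE e2m1Lo_ne (((w11sY rt : ℕ) : K) / 64) x

namespace W11Cert

/-- `sum11` is the `Finset` sum -/
theorem sum11_eq (g : Fin 11 → ℤ) : sum11 g = ∑ w, g w := by
  rw [sum11, Fin.sum_ofFn]

/-- adjacency check ⟹ no grid multiplier strictly between -/
theorem adj_of_adjOK {n n' : ℕ} (h : adjOK n n' = true) : ∀ q ∈ e2m1Lo, q ≤ n ∨ n' ≤ q := by
  simp [adjOK] at h
  rcases h with ⟨rfl, rfl⟩ | ⟨rfl, rfl⟩ | ⟨rfl, rfl⟩ | ⟨rfl, rfl⟩ | ⟨rfl, rfl⟩ | ⟨rfl, rfl⟩ | ⟨rfl, rfl⟩ <;> decide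

/-- the window anchor is a grid multiplier -/
theorem cAnc_mem (S M2 : ℕ) : cAnc S M2 ∈ e2m1Lo := by
  unfold cAnc
  split_ifs <;> decide

/-- coverage: a chained list reaches every real point of `[u, v]` -/
theorem covers_sound : ∀ (u v : ℕ) (ps : List (ℕ × ℕ)), covers u v ps = true →
    ∀ y : K, (u : K) ≤ y → y ≤ v → ∃ ab ∈ ps, ((ab.1 : ℕ) : K) ≤ y ∧ y ≤ ((ab.2 : ℕ) : K)
  | _, _, [], h => by simp [covers] at h
  | u, v, (a, b) :: ps, h => by
      intro y hlo hhi
      simp only [covers, Bool.and_eq_true, Bool.or_eq_true, decide_eq_true_eq] at h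
      obtain ⟨ha, h⟩ := h
      by_cases hyb : y ≤ (b : K)
      · exact ⟨(a, b), by simp, le_trans (by exact_mod_cast ha) hlo, hyb⟩
      · have hyb' : (b : K) < y := not_le.mp hyb
        rcases h with h | h
        · exact absurd (lt_of_lt_of_le hyb' (le_trans hhi (by exact_mod_cast h))) (lt_irrefl _)
        · obtain ⟨ab, hmem, h1, h2⟩ := covers_sound b v ps h y hyb'.le hhi
          exact ⟨ab, List.mem_cons_of_mem _ hmem, h1, h2⟩

/-- UPPER anchor: `4096 err(S/64, y)² ≤ (64 y - S n)²` for every grid multiplier `n` -/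
theorem sq_err_le_anchor {S n : ℕ} (hn : n ∈ e2m1Lo) (y : K) :
    4096 * err e2m1Lo_ne ((S : K) / 64) y ^ 2 ≤ (64 * y - (S * n : ℕ)) * (64 * y - (S * n : ℕ)) := by
  have h1 : err e2m1Lo_ne ((S : K) / 64) y ≤ |y - (S : K) / 64 * (n : K)| :=
    gridDist_le_of_mem _ (mem_sgrid hn)
  have h0 : 0 ≤ err e2m1Lo_ne ((S : K) / 64) y := e2m1_err_nonneg _ _
  have h2 : err e2m1Lo_ne ((S : K) / 64) y ^ 2 ≤ |y - (S : K) / 64 * (n : K)| ^ 2 := pow_le_pow_left₀ h0 h1 2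
  rw [sq_abs] at h2
  have h3 := mul_le_mul_of_nonneg_left h2 (show (0 : K) ≤ 4096 by norm_num)
  push_cast
  linarith [h3]

/-- LOWER anchor, `lower n n'` case -/
theorem anchor_lower {S lo hi n n' : ℕ} (hadj : adjOK n n' = true) (h1 : S * n ≤ lo)
    (h2 : 2 * hi ≤ S * (n + n')) {y : K} (hlo : (lo : K) ≤ 64 * y) (hhi : 64 * y ≤ (hi : K)) :
    (64 * y - (S * n : ℕ)) * (64 * y - (S * n : ℕ)) ≤ 4096 * err e2m1Lo_ne ((S : K) / 64) y ^ 2 := by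
  have hs : (0 : K) ≤ (S : K) / 64 := by positivity
  have h1' : ((S * n : ℕ) : K) ≤ (lo : K) := by exact_mod_cast h1
  have h2' : ((2 * hi : ℕ) : K) ≤ ((S * (n + n') : ℕ) : K) := by exact_mod_cast h2
  push_cast at h1' h2'
  have hr : y - (S : K) / 64 * n ≤ err e2m1Lo_ne ((S : K) / 64) y :=
    le_err_of_between (adj_of_adjOK hadj) hs (le_of_eq (by ring)) (by linarith)
  have hr0 : 0 ≤ y - (S : K) / 64 * n := by linarith
  have e : ((64 : K) * y - (S * n : ℕ)) * (64 * y - (S * n : ℕ)) = 4096 * (y - (S : K) / 64 * n) ^ 2 := by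
    push_cast; ring
  rw [e]
  exact mul_le_mul_of_nonneg_left (pow_le_pow_left₀ hr0 hr 2) (by norm_num)

/-- LOWER anchor, `upper n n'` case -/
theorem anchor_upper {S lo hi n n' : ℕ} (hadj : adjOK n n' = true) (h1 : S * (n + n') ≤ 2 * lo)
    (h2 : hi ≤ S * n') {y : K} (hlo : (lo : K) ≤ 64 * y) (hhi : 64 * y ≤ (hi : K)) :
    (64 * y - (S * n' : ℕ)) * (64 * y - (S * n' : ℕ)) ≤ 4096 * err e2m1Lo_ne ((S : K) / 64) y ^ 2 := by
  have hs : (0 : K) ≤ (S : K) / 64 := by positivity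
  have h1' : ((S * (n + n') : ℕ) : K) ≤ ((2 * lo : ℕ) : K) := by exact_mod_cast h1
  have h2' : (hi : K) ≤ ((S * n' : ℕ) : K) := by exact_mod_cast h2
  push_cast at h1' h2'
  have hr : (S : K) / 64 * n' - y ≤ err e2m1Lo_ne ((S : K) / 64) y :=
    le_err_of_between (adj_of_adjOK hadj) hs (by linarith) (le_of_eq (by ring))
  have hr0 : 0 ≤ (S : K) / 64 * n' - y := by linarith
  have e : ((64 : K) * y - (S * n' : ℕ)) * (64 * y - (S * n' : ℕ)) = 4096 * ((S : K) / 64 * n' - y) ^ 2 := by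
    push_cast; ring
  rw [e]
  exact mul_le_mul_of_nonneg_left (pow_le_pow_left₀ hr0 hr 2) (by norm_num)

/-- LOWER anchor above the top grid point -/
theorem anchor_top {S lo : ℕ} (h1 : 12 * S ≤ lo) {y : K} (hlo : (lo : K) ≤ 64 * y) :
    (64 * y - (12 * S : ℕ)) * (64 * y - (12 * S : ℕ)) ≤ 4096 * err e2m1Lo_ne ((S : K) / 64) y ^ 2 := by
  have hs : (0 : K) ≤ (S : K) / 64 := by positivity
  have h1' : ((12 * S : ℕ) : K) ≤ (lo : K) := by exact_mod_cast h1
  push_cast at h1'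
  have hr : y - 12 * ((S : K) / 64) ≤ err e2m1Lo_ne ((S : K) / 64) y := le_err_of_top hs (le_of_eq (by ring))
  have hr0 : 0 ≤ y - 12 * ((S : K) / 64) := by linarith
  have e : ((64 : K) * y - (12 * S : ℕ)) * (64 * y - (12 * S : ℕ)) = 4096 * (y - 12 * ((S : K) / 64)) ^ 2 := by
    push_cast; ring
  rw [e]
  exact mul_le_mul_of_nonneg_left (pow_le_pow_left₀ hr0 hr 2) (by norm_num)

/-- LOWER anchor: a valid competitor anchor gives `(64 y - H)² ≤ 4096 err_t(y)²` on its piece -/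
theorem anchor_le_sq_err {S lo hi : ℕ} {ta : W11TA} (h : taOK S lo hi ta = true) {y : K}
    (hlo : (lo : K) ≤ 64 * y) (hhi : 64 * y ≤ (hi : K)) :
    (64 * y - (taH S ta : ℕ)) * (64 * y - (taH S ta : ℕ)) ≤ 4096 * err e2m1Lo_ne ((S : K) / 64) y ^ 2 := by
  cases ta with
  | lower n n' =>
      simp only [taOK, Bool.and_eq_true, decide_eq_true_eq] at h
      exact anchor_lower h.1.1 h.1.2 h.2 hlo hhi
  | upper n n' =>
      simp only [taOK, Bool.and_eq_true, decide_eq_true_eq] at h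
      exact anchor_upper h.1.1 h.1.2 h.2 hlo hhi
  | top =>
      simp only [taOK, decide_eq_true_eq] at h
      exact anchor_top h hlo

/-- affine interpolation of an upper bound -/
theorem affine_le_of_ends {f : K → K} (A B : K) (hf : ∀ Y, f Y = A + B * Y) {P Q Y M : K}
    (hP : f P ≤ M) (hQ : f Q ≤ M) (h1 : P ≤ Y) (h2 : Y ≤ Q) : f Y ≤ M := by
  rw [hf] at hP hQ ⊢
  by_cases hB : 0 ≤ B
  · have : B * Y ≤ B * Q := mul_le_mul_of_nonneg_left h2 hB
    linarith
  · have : B * Y ≤ B * P := mul_le_mul_of_nonpos_left h1 (not_le.mp hB).le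
    linarith

/-- the real form of the helper functional (variable `Y = 64 y`) -/
def gK (c : W11Cert) (p : W11GPiece) (Y : K) : K :=
  ∑ w : Fin 11, (c.lam w : K) * ((Y - (c.sw w * p.ca w : ℕ)) * (Y - (c.sw w * p.ca w : ℕ)) -
    (Y - (taH c.st p.ta : ℕ)) * (Y - (taH c.st p.ta : ℕ)))

/-- the real form of the maximum functional (variable `A = 64 a`) -/
def rK (c : W11Cert) (p : W11RPiece) (A : K) : K :=
  ∑ w : Fin 11, (c.lam w : K) * ((A - (12 * c.st : ℕ)) * (A - (12 * c.st : ℕ)) -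
    (A - (c.sw w * p.ca w : ℕ)) * (A - (c.sw w * p.ca w : ℕ)))

omit [LinearOrder K] [IsStrictOrderedRing K] in
/-- at a natural point the real helper functional is the cast of the integer one -/
theorem gK_int (c : W11Cert) (p : W11GPiece) (P : ℕ) : c.gK p (P : K) = ((c.gval p P : ℤ) : K) := by
  simp only [gK, gval, sum11_eq, gterm, Int.cast_sum]
  push_cast
  rfl

omit [LinearOrder K] [IsStrictOrderedRing K] in
/-- at a natural point the real maximum functional is the cast of the integer one -/
theorem rK_int (c : W11Cert) (p : W11RPiece) (P : ℕ) : c.rK p (P : K) = ((c.rval p P : ℤ) : K) := by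
  simp only [rK, rval, sum11_eq, rterm, Int.cast_sum]
  push_cast
  rfl

omit [LinearOrder K] [IsStrictOrderedRing K] in
/-- the helper functional is affine -/
theorem gK_affine (c : W11Cert) (p : W11GPiece) : ∀ Y : K, c.gK p Y =
    (∑ w : Fin 11, (c.lam w : K) * (((c.sw w * p.ca w : ℕ) : K) * (c.sw w * p.ca w : ℕ) -
      ((taH c.st p.ta : ℕ) : K) * (taH c.st p.ta : ℕ))) +
    (∑ w : Fin 11, (c.lam w : K) * (2 * (((taH c.st p.ta : ℕ) : K) - (c.sw w * p.ca w : ℕ)))) * Y := by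
  intro Y
  simp only [gK, Finset.sum_mul, ← Finset.sum_add_distrib]
  refine Finset.sum_congr rfl fun w _ => ?_
  ring

omit [LinearOrder K] [IsStrictOrderedRing K] in
/-- minus the maximum functional is affine -/
theorem rK_affine (c : W11Cert) (p : W11RPiece) : ∀ A : K, -c.rK p A =
    (∑ w : Fin 11, (c.lam w : K) * (((c.sw w * p.ca w : ℕ) : K) * (c.sw w * p.ca w : ℕ) -
      ((12 * c.st : ℕ) : K) * (12 * c.st : ℕ))) +
    (∑ w : Fin 11, (c.lam w : K) * (2 * (((12 * c.st : ℕ) : K) - (c.sw w * p.ca w : ℕ)))) * A := by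
  intro A
  simp only [rK, Finset.sum_mul, ← Finset.sum_add_distrib, ← Finset.sum_neg_distrib]
  refine Finset.sum_congr rfl fun w _ => ?_
  ring

/-- the weighted error difference `Φ(y) = ∑_w lam_w (err_w(y)² - err_t(y)²)` -/
def phi (c : W11Cert) (y : K) : K :=
  ∑ w : Fin 11, (c.lam w : K) * (err e2m1Lo_ne (((c.sw w : ℕ) : K) / 64) y ^ 2 -
    err e2m1Lo_ne (((c.st : ℕ) : K) / 64) y ^ 2)

/-- termwise domination of `4096 Φ` by the helper functional on a piece with valid anchors -/
theorem phi_le_gK (c : W11Cert) {p : W11GPiece} (hta : taOK c.st p.lo p.hi p.ta = true)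
    (hmem : ∀ w, p.ca w ∈ e2m1Lo) {y : K} (hlo : ((p.lo : ℕ) : K) ≤ 64 * y) (hhi : 64 * y ≤ ((p.hi : ℕ) : K)) :
    4096 * c.phi y ≤ c.gK p (64 * y) := by
  simp only [phi, gK, Finset.mul_sum]
  refine Finset.sum_le_sum fun w _ => ?_
  have hl : (0 : K) ≤ (c.lam w : K) := by positivity
  have hu := mul_le_mul_of_nonneg_left (sq_err_le_anchor (K := K) (S := c.sw w) (hmem w) y) hl
  have hd := mul_le_mul_of_nonneg_left (anchor_le_sq_err (K := K) hta hlo hhi) hl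
  linarith

/-- on a passing helper piece with grid anchors, `Φ(y) ≤ L` -/
theorem phi_le_of_gOK (c : W11Cert) {p : W11GPiece} (hp : c.gOK p = true) (hmem : ∀ w, p.ca w ∈ e2m1Lo)
    {y : K} (hlo : ((p.lo : ℕ) : K) ≤ 64 * y) (hhi : 64 * y ≤ ((p.hi : ℕ) : K)) : c.phi y ≤ (c.L : K) := by
  simp only [gOK, Bool.and_eq_true, decide_eq_true_eq] at hp
  obtain ⟨⟨hta, hPlo⟩, hPhi⟩ := hp
  have hdom := c.phi_le_gK (K := K) hta hmem hlo hhi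
  have e1 : c.gK p ((p.lo : ℕ) : K) ≤ 4096 * (c.L : K) := by
    rw [c.gK_int]; exact_mod_cast hPlo
  have e2 : c.gK p ((p.hi : ℕ) : K) ≤ 4096 * (c.L : K) := by
    rw [c.gK_int]; exact_mod_cast hPhi
  have hends := affine_le_of_ends _ _ (c.gK_affine (K := K) p) e1 e2 hlo hhi
  linarith

/-- termwise domination of the maximum functional by `4096 (-Φ)` on a piece above the competitor's top -/
theorem rK_le_negphi (c : W11Cert) {p : W11RPiece} (htop : 12 * c.st ≤ p.lo) (hmem : ∀ w, p.ca w ∈ e2m1Lo)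
    {a : K} (hlo : ((p.lo : ℕ) : K) ≤ 64 * a) : c.rK p (64 * a) ≤ 4096 * (-c.phi a) := by
  simp only [phi, rK, ← Finset.sum_neg_distrib, Finset.mul_sum]
  refine Finset.sum_le_sum fun w _ => ?_
  have hl : (0 : K) ≤ (c.lam w : K) := by positivity
  have hu := mul_le_mul_of_nonneg_left (sq_err_le_anchor (K := K) (S := c.sw w) (hmem w) a) hl
  have hd := mul_le_mul_of_nonneg_left (anchor_top (K := K) htop hlo) hl
  linarith

/-- on a passing maximum piece with grid anchors, `Z ≤ 4096 (-Φ(a))` -/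
theorem le_negphi_of_rOK (c : W11Cert) {p : W11RPiece} (hp : c.rOK p = true) (hmem : ∀ w, p.ca w ∈ e2m1Lo)
    {a : K} (hlo : ((p.lo : ℕ) : K) ≤ 64 * a) (hhi : 64 * a ≤ ((p.hi : ℕ) : K)) :
    (c.Z : K) ≤ 4096 * (-c.phi a) := by
  simp only [rOK, Bool.and_eq_true, decide_eq_true_eq] at hp
  obtain ⟨⟨htop, hPlo⟩, hPhi⟩ := hp
  have hdom := c.rK_le_negphi (K := K) htop hmem hlo
  have e1 : -c.rK p ((p.lo : ℕ) : K) ≤ -(c.Z : K) := by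
    rw [c.rK_int]
    have : ((c.Z : ℤ) : K) ≤ ((c.rval p p.lo : ℤ) : K) := by exact_mod_cast hPlo
    push_cast at this
    linarith
  have e2 : -c.rK p ((p.hi : ℕ) : K) ≤ -(c.Z : K) := by
    rw [c.rK_int]
    have : ((c.Z : ℤ) : K) ≤ ((c.rval p p.hi : ℤ) : K) := by exact_mod_cast hPhi
    push_cast at this
    linarith
  have hends := affine_le_of_ends (f := fun A => -c.rK p A) _ _ (c.rK_affine (K := K) p) e1 e2 hlo hhi
  linarith

omit [LinearOrder K] [IsStrictOrderedRing K] in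
/-- the anchors of the generated helper pieces are grid multipliers -/
theorem gp_mem {c : W11Cert} {p : W11GPiece} (hp : p ∈ c.gp) : ∀ w, p.ca w ∈ e2m1Lo := by
  simp only [gp, List.mem_map] at hp
  obtain ⟨ab, _, rfl⟩ := hp
  exact fun w => cAnc_mem _ _

omit [LinearOrder K] [IsStrictOrderedRing K] in
/-- the anchors of the generated maximum pieces are grid multipliers -/
theorem rp_mem {c : W11Cert} {p : W11RPiece} (hp : p ∈ c.rp) : ∀ w, p.ca w ∈ e2m1Lo := by
  simp only [rp, List.mem_map] at hp
  obtain ⟨ab, _, rfl⟩ := hp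
  exact fun w => cAnc_mem _ _

/-- helper bound: every `y ∈ [0, 6 X(c_nc)]` has `Φ(y) ≤ L` -/
theorem phi_le (c : W11Cert) {N : ℕ} (h : c.check N = true) {y : K} (h0 : 0 ≤ y)
    (h1 : y ≤ ((12 * w11sY (c.m + 16) : ℕ) : K) / 64) : c.phi y ≤ (c.L : K) := by
  simp only [check, Bool.and_eq_true, decide_eq_true_eq] at h
  obtain ⟨⟨⟨⟨hg, _⟩, hcov⟩, _⟩, _⟩ := h
  have hhi : (64 : K) * y ≤ ((c.hiY : ℕ) : K) := by
    have := mul_le_mul_of_nonneg_left h1 (show (0 : K) ≤ 64 by norm_num)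
    simp only [hiY]; linarith
  obtain ⟨ab, hmem, hlo, hhi⟩ := covers_sound (K := K) _ _ _ hcov (64 * y) (by push_cast; linarith) hhi
  obtain ⟨p, hp, rfl⟩ := List.mem_map.mp hmem
  exact c.phi_le_of_gOK (List.all_eq_true.mp hg p hp) (gp_mem hp) hlo hhi

/-- maximum bound: every `a` in the class interval has `Z ≤ 4096 (-Φ(a))` -/
theorem le_negphi (c : W11Cert) {N : ℕ} (h : c.check N = true) {a : K}
    (h0 : ((12 * w11sY (c.m + 15) : ℕ) : K) / 64 < a) (h1 : a ≤ ((12 * w11sY (c.m + 16) : ℕ) : K) / 64) :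
    (c.Z : K) ≤ 4096 * (-c.phi a) := by
  simp only [check, Bool.and_eq_true, decide_eq_true_eq] at h
  obtain ⟨⟨⟨⟨_, hr⟩, _⟩, hcov⟩, _⟩ := h
  have hlo : ((c.loY : ℕ) : K) ≤ 64 * a := by
    have := mul_le_mul_of_nonneg_left h0.le (show (0 : K) ≤ 64 by norm_num)
    simp only [loY]; linarith
  have hhi : (64 : K) * a ≤ ((c.hiY : ℕ) : K) := by
    have := mul_le_mul_of_nonneg_left h1 (show (0 : K) ≤ 64 by norm_num)
    simp only [hiY]; linarith
  obtain ⟨ab, hmem, hlo, hhi⟩ := covers_sound (K := K) _ _ _ hcov (64 * a) hlo hhi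
  obtain ⟨p, hp, rfl⟩ := List.mem_map.mp hmem
  exact c.le_negphi_of_rOK (List.all_eq_true.mp hr p hp) (rp_mem hp) hlo hhi

/-- SOUNDNESS of the checker. -/
theorem sound (c : W11Cert) {N : ℕ} (h : c.check N = true) : W11CellWin K c.m (c.m + 16 - c.d) N := by
  intro k x i₀ hk hx hlo hhi
  have hfin : N * 4096 * c.L < c.Z := by
    simp only [check, Bool.and_eq_true, decide_eq_true_eq] at h
    exact h.2
  -- the weighted sum of SSE differences is the block sum of `-Φ`
  set D : K := ∑ w : Fin 11, (c.lam w : K) *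
    (blockSSE e2m1Lo_ne (((c.st : ℕ) : K) / 64) x - blockSSE e2m1Lo_ne (((c.sw w : ℕ) : K) / 64) x) with hD
  have hDsum : D = ∑ i, -c.phi (x i) := by
    simp only [hD, blockSSE, phi, ← Finset.sum_sub_distrib, Finset.mul_sum, ← Finset.sum_neg_distrib]
    rw [Finset.sum_comm]
    refine Finset.sum_congr rfl fun i _ => Finset.sum_congr rfl fun w _ => ?_
    ring
  -- lower bound of the block sum
  have hi₀ : (c.Z : K) / 4096 ≤ -c.phi (x i₀) := by
    have := c.le_negphi (K := K) h hlo hhi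
    have h4 : (0 : K) < 4096 := by norm_num
    rw [div_le_iff₀ h4]; linarith
  have hrest : ∀ i ∈ Finset.univ.erase i₀, -(c.L : K) ≤ -c.phi (x i) := by
    intro i _
    have := c.phi_le (K := K) h (hx i).1 (le_trans (hx i).2 hhi)
    linarith
  have hcard : (Finset.univ.erase i₀).card = k - 1 := by
    rw [Finset.card_erase_of_mem (Finset.mem_univ _), Finset.card_univ, Fintype.card_fin]
  have hsum : (c.Z : K) / 4096 - N * c.L ≤ D := by
    rw [hDsum, ← Finset.add_sum_erase _ _ (Finset.mem_univ i₀)]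
    have h2 := Finset.card_nsmul_le_sum _ _ _ hrest
    rw [hcard, nsmul_eq_mul] at h2
    have hk1 : ((k - 1 : ℕ) : K) ≤ (N : K) := by exact_mod_cast (by omega : k - 1 ≤ N)
    have hL : (0 : K) ≤ (c.L : K) := by positivity
    have h3 := mul_le_mul_of_nonneg_right hk1 hL
    linarith [h2, h3]
  have hpos : 0 < D := by
    have hf : ((N * 4096 * c.L : ℕ) : K) < ((c.Z : ℕ) : K) := by exact_mod_cast hfin
    push_cast at hf
    have h4 : (0 : K) < 4096 := by norm_num
    have : (N : K) * c.L < (c.Z : K) / 4096 := by rw [lt_div_iff₀ h4]; linarith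
    linarith
  -- hence some window code does not lose against the competitor
  by_contra hne
  have : D ≤ 0 := by
    rw [hD]
    refine Finset.sum_nonpos fun w _ => mul_nonpos_of_nonneg_of_nonpos (by positivity) ?_
    have := not_le.mp (not_exists.mp hne w)
    simp only [W11Cert.sw, W11Cert.st]
    linarith
  linarith

end W11Cert

end Sound

end Summit.Ventures.CertifiedArithmetic.LowPrec.Opt
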